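import Summits.MatrixMultiplication.MatrixMultiplication.Theorems.SoloInformedCwTwoDoorToMixed
import Mathlib.Data.Fin.Tuple.Sort
import Summits.MatrixMultiplication.MatrixMultiplication.Theorems.SoloInformedCwTwoValueWeights

/-!
# D7-closure at the door, in full generality: HALL-6 ⟹ no integer weighted design beats `4^N`

`SoloInformedCwTwoDoorToMixed` proved the closure corollaries for door designs with increasingly ORDERED digit
triples.  Here the ordering assumption is removed: a door design is invariant under permuting the three digits of
each pair together with their weights (`isDoorDesign_perm`), its three digits in a pair are automatically pairwise
distinct (`IsDoorDesign.apply_ne` — two symmetric non-transversal relations cannot both be heavy), so sorting each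
triple (`Tuple.sort`) reduces to the ordered case.  Results:

* `doorClosure_of_hallSixConjecture_general : HallSixConjecture → IsDoorDesign F θ → 4 ^ N ≤ digitSigma F + 1` —
  under HALL-6, NO integer weighted design fed to the door `algBorderRank_kroneckerPow_cwTensor_two_le_sigma_succ`
  certifies a border-rank bound below `4^N = dim`, i.e. monomial degenerations of `T_{cw,2}^{⊠N}` into truncated
  polynomial algebras never beat the trivial bound;
* `doorClosure_tight_general` — unconditionally so when every digit triple is an arithmetic progression.

Written by the solo-informed seat (gen 13); standard axioms only.
-/

namespace Summit.MatrixMultiplication.MatrixMultiplication.Theorems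

open Finset

/-- Every pair of distinct letters of `Fin 3` has a third letter. -/
theorem exists_third (i j : Fin 3) (hij : i ≠ j) : ∃ l : Fin 3, i ≠ l ∧ j ≠ l := by
  revert i j; decide

/-- **Door designs are invariant under permuting the digits of each pair together with their weights.** -/
theorem isDoorDesign_perm {N : ℕ} (F : Fin N → Fin 3 → ℤ) (θ : Fin N → Fin 3 → ℕ)
    (π : Fin N → Equiv.Perm (Fin 3)) (h : IsDoorDesign F θ) :
    IsDoorDesign (fun k j => F k (π k j)) (fun k j => θ k (π k j)) := by
  intro u v w hsum
  have hF : ∀ k, F k (π k 0) + F k (π k 1) + F k (π k 2) = F k 0 + F k 1 + F k 2 := fun k => by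
    have := Equiv.sum_comp (π k) (F k)
    simpa [Fin.sum_univ_three] using this
  have hθ : ∀ k, θ k (π k 0) + θ k (π k 1) + θ k (π k 2) = θ k 0 + θ k 1 + θ k 2 := fun k => by
    have := Equiv.sum_comp (π k) (θ k)
    simpa [Fin.sum_univ_three] using this
  rcases h (fun k => π k (u k)) (fun k => π k (v k)) (fun k => π k (w k))
      (by simpa [wordSum, hF] using hsum) with htr | hwt
  · exact Or.inl fun k =>
      ⟨fun e => (htr k).1 (by rw [e]), fun e => (htr k).2.1 (by rw [e]), fun e => (htr k).2.2 (by rw [e])⟩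
  · exact Or.inr (by simpa [wordWt, hθ] using hwt)

/-- **The three digits of a pair of a door design are pairwise distinct**: if two coincided, the two symmetric
non-transversal relations doubling either of them would both have to be heavy, which is absurd. -/
theorem IsDoorDesign.apply_ne {N : ℕ} {F : Fin N → Fin 3 → ℤ} {θ : Fin N → Fin 3 → ℕ} (h : IsDoorDesign F θ)
    (k : Fin N) {i j : Fin 3} (hij : i ≠ j) : F k i ≠ F k j := by
  classical
  intro e
  obtain ⟨l, hil, hjl⟩ := exists_third i j hij
  -- words: letters (x, x, l) at pair k, the transversal pattern (i, j, l) elsewhere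
  let U : Fin 3 → Fin N → Fin 3 := fun x k' => if k' = k then x else i
  let V : Fin 3 → Fin N → Fin 3 := fun x k' => if k' = k then x else j
  let W : Fin N → Fin 3 := fun _ => l
  have hval : ∀ x, x = i ∨ x = j →
      wordSum F (U x) + wordSum F (V x) + wordSum F W = ∑ k', (F k' 0 + F k' 1 + F k' 2) := by
    intro x hx
    simp only [wordSum, ← Finset.sum_add_distrib]
    refine Finset.sum_congr rfl fun k' _ => ?_
    have h3 := sum_three_of_distinct (F k') hij hil hjl
    by_cases hk : k' = k
    · subst hk
      simp only [U, V, W, if_true]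
      rcases hx with rfl | rfl <;> linarith
    · simp only [U, V, W, hk, if_false]
      exact h3
  have hS : (wordWt θ (U i) + wordWt θ (V i) + wordWt θ W) + (wordWt θ (U j) + wordWt θ (V j) + wordWt θ W) =
      2 * ∑ k', (θ k' 0 + θ k' 1 + θ k' 2) := by
    simp only [wordWt, ← Finset.sum_add_distrib, Finset.mul_sum]
    refine Finset.sum_congr rfl fun k' _ => ?_
    have h3 := sum_three_of_distinct (θ k') hij hil hjl
    by_cases hk : k' = k
    · subst hk
      simp only [U, V, W, if_true]
      omega
    · simp only [U, V, W, hk, if_false]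
      omega
  rcases h (U i) (V i) W (hval i (Or.inl rfl)) with htr | hwi
  · exact (htr k).1 (by simp [U, V])
  rcases h (U j) (V j) W (hval j (Or.inr rfl)) with htr | hwj
  · exact (htr k).1 (by simp [U, V])
  omega

/-- **D7-closure from HALL-6, general form.**  Under HALL-6, every integer weighted design `(F, θ)` of door
`algBorderRank_kroneckerPow_cwTensor_two_le_sigma_succ` has `4 ^ N ≤ digitSigma F + 1`: the door cannot certify a
border-rank bound for `T_{cw,2}^{⊠N}` below its dimension `4^N`. -/
theorem doorClosure_of_hallSixConjecture_general (hconj : HallSixConjecture) {N : ℕ} (F θ : Fin N → Fin 3 → ℕ)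
    (hdes : IsDoorDesign (fun k j => (F k j : ℤ)) θ) : 4 ^ N ≤ digitSigma F + 1 := by
  classical
  let π : Fin N → Equiv.Perm (Fin 3) := fun k => Tuple.sort (F k)
  have hinj : ∀ k, Function.Injective (F k) := fun k i j hFij => by
    by_contra hij
    exact hdes.apply_ne k hij (by exact_mod_cast hFij)
  have hmono : ∀ k, StrictMono (F k ∘ π k) := fun k =>
    (Tuple.monotone_sort (F k)).strictMono_of_injective ((hinj k).comp (π k).injective)
  have hord : ∀ k, F k (π k 0) < F k (π k 1) ∧ F k (π k 1) < F k (π k 2) := fun k =>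
    ⟨hmono k (show (0 : Fin 3) < 1 by decide), hmono k (show (1 : Fin 3) < 2 by decide)⟩
  have hdes' : IsDoorDesign (fun k j => ((F k (π k j) : ℕ) : ℤ)) (fun k j => θ k (π k j)) :=
    isDoorDesign_perm (fun k j => (F k j : ℤ)) θ π hdes
  have h := doorClosure_of_hallSixConjecture_of_ordered hconj (fun k j => F k (π k j)) (fun k j => θ k (π k j))
    hord hdes'
  have hσ : digitSigma (fun k j => F k (π k j)) = digitSigma F := by
    unfold digitSigma
    refine Finset.sum_congr rfl fun k _ => ?_
    have := Equiv.sum_comp (π k) (F k)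
    simpa [Fin.sum_univ_three] using this
  omega

/-- **Unconditional closure for arithmetic-progression digit triples, general form**: if the three digits of every
pair, listed increasingly, form an arithmetic progression, the design has `4 ^ N ≤ digitSigma F + 1`. -/
theorem doorClosure_tight_general {N : ℕ} (F θ : Fin N → Fin 3 → ℕ)
    (htight : ∀ k (i j l : Fin 3), F k i < F k j → F k j < F k l → F k l - F k i = 2 * (F k j - F k i))
    (hdes : IsDoorDesign (fun k j => (F k j : ℤ)) θ) : 4 ^ N ≤ digitSigma F + 1 := by
  classical
  let π : Fin N → Equiv.Perm (Fin 3) := fun k => Tuple.sort (F k)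
  have hinj : ∀ k, Function.Injective (F k) := fun k i j hFij => by
    by_contra hij
    exact hdes.apply_ne k hij (by exact_mod_cast hFij)
  have hmono : ∀ k, StrictMono (F k ∘ π k) := fun k =>
    (Tuple.monotone_sort (F k)).strictMono_of_injective ((hinj k).comp (π k).injective)
  have hord : ∀ k, F k (π k 0) < F k (π k 1) ∧ F k (π k 1) < F k (π k 2) := fun k =>
    ⟨hmono k (show (0 : Fin 3) < 1 by decide), hmono k (show (1 : Fin 3) < 2 by decide)⟩
  have hdes' : IsDoorDesign (fun k j => ((F k (π k j) : ℕ) : ℤ)) (fun k j => θ k (π k j)) :=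
    isDoorDesign_perm (fun k j => (F k j : ℤ)) θ π hdes
  have h := doorClosure_tight_of_ordered (fun k j => F k (π k j)) (fun k j => θ k (π k j)) hord
    (fun k => htight k _ _ _ (hord k).1 (hord k).2) hdes'
  have hσ : digitSigma (fun k j => F k (π k j)) = digitSigma F := by
    unfold digitSigma
    refine Finset.sum_congr rfl fun k _ => ?_
    have := Equiv.sum_comp (π k) (F k)
    simpa [Fin.sum_univ_three] using this
  omega

end Summit.MatrixMultiplication.MatrixMultiplication.Theorems
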